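import Literature.AlgebraicGeometry.Frobenioids.RealificationModelRow
import Literature.AnabelianGeometry.EtaleTheta.RealifiedDivisorMonoidsOfRlfQ
import Literature.AnabelianGeometry.EtaleTheta.TemperedFrobenioidToy
import Literature.AnabelianGeometry.EtaleTheta.BiKummerThm44SubModelConnectedBaseInj
import Literature.AnabelianGeometry.EtaleTheta.Discharge.Sec4Prop42SubRootLawModel
import Literature.AnabelianGeometry.EtaleTheta.Discharge.Sec3Cor38CriterionCoord
import Literature.AnabelianGeometry.EtaleTheta.Discharge.Sec3Prop34CnstOfRlfR
import Literature.AnabelianGeometry.EtaleTheta.Discharge.Sec3Prop34CnstOfRlfRChainModel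
import Literature.AnabelianGeometry.EtaleTheta.Discharge.Sec3Prop34CnstOfRlfRNegative
import Literature.AnabelianGeometry.EtaleTheta.Discharge.Sec3BLambdaInjectiveOfGaloisCoveringConnected

/-!
# [EtTh] §3–§4: the residual LAWS of the Def. 3.3 (iii) / Def. 3.6 (i)(ii) data as NAMED PREDICATES

S. Mochizuki, *The étale theta function and its Frobenioid-theoretic manifestations*, Publ. RIMS **45** (2009)
[MochizukiEtTh2009], §3 Def. 3.3 (iii) PDF p.73, Prop. 3.4 (ii) p.74, Def. 3.6 (i)(ii) pp.76–77, Thm. 3.7 (iii)(iv)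
pp.79–80, Cor. 3.8 p.81; §4 Prop. 4.2 (iii) pp.88–90 with ERRATUM E2 = [IUTchI] Rmk. 3.2.4 (i)(a)/(iv)(A)
(«tempered-meromorphic»: condition (a) «for every `N ∈ ℕ_{≥1}`, `f` admits an `N`-th root over some tempered
covering»).  abc-iut cell, layer L2; the 13:00Z v-next census (plan/L2/VNEXT-CENSUS-L2.md, items A2, A6, A7, A9,
A10), class (c) of the L2 DEFS lane: **Prop-valued predicates over EXISTING fields, no data, no instance, no
notation; nothing landed is edited**.  Seat abc-iut-L2-t3 (gen 5), owner of `DivisorMonoids` /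
`RealifiedDivisorMonoids` / `TemperedFrobenioid`.

WHY.  The discharge files of §3/§4 isolate a handful of properties of the GENUINE log-divisor data that the typed
interface (`DivisorMonoids`, `RealifiedDivisorMonoids`, `TemperedFrobenioid`) does not record and that are NOT formal
consequences of it (kernel countermodels exist for each).  They travel through the tree as anonymous binders
(`hR₀`, `hBD`, `hΛ`, `hQ`, `hE`) repeated verbatim in dozens of signatures.  This file gives each binder of record ONE
name (the binder VERBATIM as the body of a `def … : Prop`), re-keys its first consumer BY NAME, and records the
non-vacuity evidence already in the tree (a constructed model where the law HOLDS and, where one exists, a model where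
it FAILS), so that consumers and the L2 certificate can quote a predicate instead of a formula:

* §1 `TemperedFrobenioid.BaseRootLaw tf IG` (census A10) — abc-iut-w4-d044's `hR₀` of `rootLaw_of_baseRootLaw`
  (GAP G-w4d044-3): «every `b ∈ B₀^Λ(Y_A)` acquires an `N`-th root in `B₀^Λ(Y_{A'})` over some `IG`-cover `A' ⟶ A`» —
  the ERRATUM E2 «tempered-meromorphic» clause of Def. 3.1 (ii)/3.3 (iii) read at the level where Prop. 4.2 (iii)
  consumes it.  NEW THEOREMS: `baseRootLaw_of_isPerfect` (a perfect = uniquely divisible `B₀^Λ` satisfies the law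
  with TRIVIAL covers), hence `baseRootLaw_ofRlfQ` (`B₀^ℚ = B₀^pf`) and `baseRootLaw_ofRlfR` (`B₀^ℝ = ℝ·Φ₀^birat`, an
  `ℝ`-span): **the E2 root clause has content only for monoid type `ℤ`** — the §4 case; NV `Toy.not_baseRootLaw`
  (abc-iut-L2-t3's `Λ = ℤ` toy, `B₀ = ℤ` over the one-object base: `1 ∈ ℤ` has no square root over any cover).
* §2 `TemperedFrobenioid.BaseInj C₀` (census A9) — abc-iut-w5-d179's BASE-IMAGE binder `hBD` of
  `isMonoidOn_ratFnFunctor_of_baseInj` («pull-backs of `B₀^Λ` along the images of the morphisms of `D` are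
  injective»); NOT the `D₀`-wide `hBinj` (false over `Action (Type u) G`, pull-back to the empty `G`-set), which
  implies it (`BaseInj.of_hBinj`).  Positive instance: abc-iut-w6-d048's theorem at the connected constructed data
  (`baseInj_ofRlfRWeak_ofGaloisActionConnected`, any base category; label R292: that class is inhabited in the tree
  only once a non-degenerate `LogDivisorModel` lands).
* §3 `TemperedFrobenioid.BsFldZQ C` / `TemperedFrobenioid.PfAtQ C` (census A6 / A7) — abc-iut-w4-d084's `hΛ`
  («`Φ^{bs-fld}(W)` is `ℤ`- or `ℚ`-monoprime») and `hQ` («`Φ(W)` has `ℚ`-monoprime localized perfections», GAP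
  G-w4d084-3) of `bsFldPreStepLimitCriterion_of_coord`; `bsFldZQ_of_pfAtQ` (`hΛ ⇐ hQ + hNZ`, p431193's
  `isZQMonoprime_bsFld`); Toy instance of `BsFldZQ`.
* §4 `DivisorMonoids.EffRealSpan dm hpf` (census A2) — abc-iut-w5-d130's `hE` of `Prop34Cnst.ofRlfR_of_eff`
  (GAP G-w5d130-1: «an element of `ℝ·Φ₀^birat(Y)` with EFFECTIVE image lies in `ℝ·Φ₀^cnst(Y)`», the `Λ = ℝ` reading of
  Prop. 3.4 (ii)); `effRealSpan_iff` (⟺ clause 1 of `Prop34Cnst (ofRlfR dm hpf) cnst`); HOLDS at abc-iut-w6-d046's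
  chain model (`Sec3Prop34CnstOfRlfRChainModel.effRealSpan`), FAILS at abc-iut-w5-d130's `√2`-cone
  (`Sec3Prop34CnstOfRlfRNegative.not_effRealSpan`).

HONEST FRAMING: refereed pre-IUT material ([FrdI] 2008, [EtTh] 2009); these are NAMES for hypotheses on abstract data
plus re-keyed implications and model instances — not discharges at the genuine curve data, which the tree does not
construct; «typed ≠ proved»; nothing here bears on the disputed [IUTchIII] Cor. 3.12.
-/

noncomputable section

namespace Literature.AnabelianGeometry.EtaleTheta

open CategoryTheory Opposite Function Literature.AlgebraicGeometry.Frobenioids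
open Literature.AnabelianGeometry.SemiGraphs

universe u₀ v₀ u v w u₁ v₁

/-! ### §1 The tempered-meromorphic ROOT LAW for `B₀^Λ` along the base (census A10, ERRATUM E2) -/

namespace TemperedFrobenioid

section BaseRootLaw

variable {D₀ : Type u₀} [Category.{v₀} D₀] {V : FrdIMonoidStub.{w}} {T : RealifiedDivisorMonoids (D₀ := D₀) V}
  {D : Type u} [Category.{v} D] {VD : FrdICatStub.{u, v, w} D} (tf : TemperedFrobenioid T D VD)

/-- **The root law for `B₀^Λ` along the base functor** (census A10; ERRATUM E2 «tempered-meromorphic», [IUTchI]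
Rmk. 3.2.4 (i)(a): «for every `N ∈ ℕ_{≥1}`, `f` admits an `N`-th root over some tempered covering»), read at the level
where the proof of Prop. 4.2 (iii) uses it (p.89 «since … log-meromorphic [tempered-meromorphic, E2] … admits an
`N`-th root over some tempered covering»): for every `N ≥ 1`, every object `A` of `D` satisfying `IG` (in §4: `A`
Galois) and every `b ∈ B₀^Λ(Y_A)` there are an `IG`-object `A'`, a morphism `c : A' ⟶ A` and `b' ∈ B₀^Λ(Y_{A'})`
with `b'^N = B₀^Λ(Y_c)(b)`.  This is abc-iut-w4-d044's binder `hR₀` of `rootLaw_of_baseRootLaw` VERBATIM.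
[cite: MochizukiEtTh2009, Prop 4.2 (iii) p.89] -/
def BaseRootLaw (IG : D → Prop) : Prop :=
  ∀ (N : ℕ+) (A : D), IG A → ∀ b : T.BΛ.obj (op (tf.base.obj A)),
    ∃ (A' : D) (_ : IG A') (c : A' ⟶ A) (b' : T.BΛ.obj (op (tf.base.obj A'))),
      b' ^ (N : ℕ) = (T.BΛ.map (tf.base.map c).op).hom b

/-- Re-key of abc-iut-w4-d044's `rootLaw_of_baseRootLaw` (G-w4d044-3) on the named predicate: the root law `hR` for
`B = B₀^Λ|_D ×_{(Φ^{ℝ-log})^gp} Φ^gp` from `BaseRootLaw`, `Φ` perfect and injectivity of `N`-th powers in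
`(Φ^{ℝ-log})^gp`. [cite: MochizukiEtTh2009, Def 3.6 p.77] -/
theorem rootLaw_of_baseRootLaw' (IG : D → Prop) (hP : ∀ A : Dᵒᵖ, IsPerfect (tf.Φ.carrier A))
    (hTF : ∀ (A : D) (N : ℕ), 0 < N →
      Function.Injective fun x : Algebra.GrothendieckGroup (T.ΦR.obj (op (tf.base.obj A))) => x ^ N)
    (hR₀ : tf.BaseRootLaw IG) (N : ℕ+) (A : D) (hA : IG A) (f : tf.ratFnFunctor.obj (op A)) :
    ∃ (A' : D) (_ : IG A') (c : A' ⟶ A) (g : tf.ratFnFunctor.obj (op A')),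
      g ^ (N : ℕ) = pull tf.ratFnFunctor c f :=
  tf.rootLaw_of_baseRootLaw IG hP hTF hR₀ N A hA f

/-- **A perfect `B₀^Λ` satisfies the root law with TRIVIAL covers**: if `B₀^Λ(Y_A)` is perfect (every `N`-th power map
bijective) for every `IG`-object `A`, then `BaseRootLaw IG` holds with `A' := A`, `c := 𝟙_A`.
[cite: MochizukiEtTh2009, Prop 4.2 (iii) p.89] -/
theorem baseRootLaw_of_isPerfect (IG : D → Prop)
    (hB : ∀ A : D, IG A → IsPerfect (T.BΛ.obj (op (tf.base.obj A)))) : tf.BaseRootLaw IG := by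
  intro N A hA b
  refine ⟨A, hA, 𝟙 A, (hB A hA).root N b, ?_⟩
  rw [(hB A hA).root_pow, tf.base.map_id, op_id, T.BΛ.map_id]
  rfl

end BaseRootLaw

section BaseRootLawQR

variable {D₀ : Type u} [Category.{v} D₀] {dm : DivisorMonoids.{u, v, w} D₀}
  {hpf : ∀ Y : D₀ᵒᵖ, IsPerfFactorial (dm.Φ₀.obj Y)}
  {D : Type u₀} [Category.{v₀} D] {VD : FrdICatStub.{u₀, v₀, w} D}

/-- **Monoid type `ℚ`: the root law is AUTOMATIC** — `B₀^ℚ := B₀^pf` (Def. 3.6 (i)) is a perfection, hence perfect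
(abc-iut-L1's `isPerfect_perfection`). [cite: MochizukiEtTh2009, Def 3.6 (i) p.76] -/
theorem baseRootLaw_ofRlfQ (C₀ : TemperedFrobenioid (RealifiedDivisorMonoids.ofRlfQ dm hpf) D VD) (IG : D → Prop) :
    C₀.BaseRootLaw IG :=
  C₀.baseRootLaw_of_isPerfect IG fun A _ => by
    change IsPerfect (Perfection (dm.B₀.obj (op (C₀.base.obj A))))
    exact isPerfect_perfection

/-- **Monoid type `ℝ`: the root law is AUTOMATIC** — `B₀^ℝ := ℝ·Φ₀^birat ⊆ (Φ₀^rlf)^gp` (Def. 3.6 (i)) is an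
`ℝ`-subspace (abc-iut-L1-t5's `rsmul_mem_realSpan`), so `b' := (1/N)•b` is an `N`-th root of `b` over `A' := A`.
Together with `baseRootLaw_ofRlfQ`: the ERRATUM E2 root clause has content only for monoid type `ℤ` (the case of §4).
[cite: MochizukiEtTh2009, Def 3.6 (i) p.76] -/
theorem baseRootLaw_ofRlfR (C₀ : TemperedFrobenioid (RealifiedDivisorMonoids.ofRlfR dm hpf) D VD) (IG : D → Prop) :
    C₀.BaseRootLaw IG := by
  intro N A hA b
  have hN : ((N : ℕ) : ℝ) ≠ 0 := Nat.cast_ne_zero.mpr N.ne_zero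
  refine ⟨A, hA, 𝟙 A,
    ⟨(RealifiedDivisorMonoids.realData dm hpf).rsmul (C₀.base.obj A) (((N : ℕ) : ℝ)⁻¹) b.1,
      RealificationDataLemmas.rsmul_mem_realSpan _ dm.biratGp (C₀.base.obj A) _ b.2⟩, ?_⟩
  rw [C₀.base.map_id, op_id, (RealifiedDivisorMonoids.ofRlfR dm hpf).BΛ.map_id]
  apply Subtype.ext
  change (RealifiedDivisorMonoids.realData dm hpf).rsmul (C₀.base.obj A) (((N : ℕ) : ℝ)⁻¹) b.1 ^ (N : ℕ) = b.1
  rw [← (RealifiedDivisorMonoids.realData dm hpf).rsmul_natCast (C₀.base.obj A) N,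
    ← (RealifiedDivisorMonoids.realData dm hpf).rsmul_mul, mul_inv_cancel₀ hN,
    (RealifiedDivisorMonoids.realData dm hpf).rsmul_one]

end BaseRootLawQR

end TemperedFrobenioid

namespace Toy

/-- **Monoid type `ℤ`: the root law has CONTENT** — at abc-iut-L2-t3's toy (`B₀ = B₀^Λ = ℤ`, one-object base, so
every cover is the identity) `BaseRootLaw` FAILS for the trivially true `IG`: the generator `1 ∈ ℤ` has no square
root.  (So the predicate is a genuine interface input at `Λ = ℤ`, as print's E2 discussion says.)
[cite: MochizukiEtTh2009, Prop 4.2 (iii) p.89] -/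
theorem not_baseRootLaw : ¬ temperedFrobenioid.BaseRootLaw fun _ => True := by
  intro h
  obtain ⟨A', -, c, b', hb'⟩ := h 2 ⟨PUnit.unit⟩ trivial (Multiplicative.ofAdd (1 : ℤ))
  have hb'' : (show Multiplicative ℤ from b') ^ ((2 : ℕ+) : ℕ) = Multiplicative.ofAdd (1 : ℤ) := hb'
  have h2 := congrArg Multiplicative.toAdd hb''
  rw [toAdd_pow, toAdd_ofAdd, nsmul_eq_mul] at h2
  simp only [PNat.val_ofNat, Nat.cast_ofNat] at h2
  omega

end Toy

/-! ### §2 Injectivity of `B₀^Λ` along the images of the morphisms of the base (census A9) -/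

namespace TemperedFrobenioid

section BaseInj

variable {D₀ : Type u₀} [Category.{v₀} D₀] {V : FrdIMonoidStub.{w}} {T : RealifiedDivisorMonoids (D₀ := D₀) V}
  {D : Type u} [Category.{v} D] {VD : FrdICatStub.{u, v, w} D}

/-- **`B₀^Λ` is injective along the base** (census A9, BASE-IMAGE form): for every morphism `α : B ⟶ A` of `D` the
pull-back `B₀^Λ(Y_α) : B₀^Λ(Y_A) → B₀^Λ(Y_B)` is injective — at print's `D₀ = B^temp(X^log)⁰` (connected objects) the
transition maps of `B₀(Y) = lim Mero(Z_∞)^{Gal(Z_∞/Y)}` are inclusions of invariants (Def. 3.3 (iii)).  This is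
abc-iut-w5-d179's binder `hBD` of `isMonoidOn_ratFnFunctor_of_baseInj` VERBATIM; the `D₀`-wide form `hBinj` (all
morphisms of an abstract `D₀`) is FALSE over `D₀ = Action (Type u) G` and is deliberately NOT the predicate.
[cite: MochizukiEtTh2009, Def 3.3 (iii) p.73] -/
def BaseInj (C₀ : TemperedFrobenioid T D VD) : Prop :=
  ∀ ⦃A B : D⦄ (α : B ⟶ A), Injective (T.BΛ.map (C₀.base.map α).op).hom

/-- The `D₀`-wide binder `hBinj` implies `BaseInj`. [cite: MochizukiEtTh2009, Def 3.6 p.77] -/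
theorem BaseInj.of_hBinj (C₀ : TemperedFrobenioid T D VD)
    (hBinj : ∀ {Y Y' : D₀ᵒᵖ} (g : Y ⟶ Y'), Injective (T.BΛ.map g).hom) : C₀.BaseInj :=
  fun _ _ α => hBinj (C₀.base.map α).op

variable {IsRational IsStrictlyRational : (Dᵒᵖ ⥤ CommMonCat.{w}) → Prop}
  (C₀ : TemperedFrobenioid T D (treeCatVocab D IsRational IsStrictlyRational))

/-- Re-key of `isMonoidOn_ratFnFunctor_of_baseInj` (p436787) on the named predicate: «`B` is a monoid on `D`»
([FrdI] Def. 1.1 (ii)) from `BaseInj` and «FSM-morphisms of `D` are isomorphisms».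
[cite: MochizukiEtTh2009, Def 3.6 p.77] -/
theorem isMonoidOn_ratFnFunctor_of_baseInj' (h : C₀.BaseInj)
    (hFSM : ∀ {A B : D} (α : B ⟶ A), IsFSM α → IsIso α) : IsMonoidOn C₀.ratFnFunctor :=
  C₀.isMonoidOn_ratFnFunctor_of_baseInj (fun α => h α) hFSM

/-- Re-key of `isFrobenioid_of_baseInj` (p436787): «`C` is a Frobenioid» from `BaseInj` and the FSM clause.
[cite: MochizukiEtTh2009, Def 3.6 p.77] -/
theorem isFrobenioid_of_baseInj' (h : C₀.BaseInj) (hFSM : ∀ {A B : D} (α : B ⟶ A), IsFSM α → IsIso α) :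
    PreFrobenioid.IsFrobenioid C₀.toElem :=
  C₀.isFrobenioid_of_baseInj (fun α => h α) hFSM

end BaseInj

section BaseInjGenuine

open LogDivisorModel.GaloisAction

variable {Z : LogDivisorModel.{u}} {G : Type u} [Group G] (A : Z.GaloisAction G) (hZ : Z.CuspLaws)
  (hpf : ∀ Y : ((isConnectedGSet (G := G)).FullSubcategory)ᵒᵖ,
    IsPerfFactorialCof ((DivisorMonoids.ofGaloisActionConnected A hZ).Φ₀.obj Y))
  {D : Type u₀} [Category.{v₀} D] {VD : FrdICatStub.{u₀, v₀, u} D}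

/-- **`BaseInj` HOLDS for every tempered Frobenioid of monoid type `ℝ` over the CONSTRUCTED Def. 3.3 (iii) data of
the connected coverings dominated by `Z^log_∞`** (any base category `D`) — abc-iut-w6-d048's
`ofRlfRWeak_hBinj_ofGaloisActionConnected` (p439556) BY NAME.  Honest label of record (L2-lead R292, finding
F-w6d048g3-1): the implication is unconditional, but the class of such `C₀` is INHABITED IN THE TREE only once a
non-degenerate `LogDivisorModel` (non-trivial `Φ₀`, so that Def. 3.6 (ii)(b) is satisfiable) lands — today's sole
inhabitant `LogDivisorModel.toy` has trivial `Φ₀`. [cite: MochizukiEtTh2009, Def 3.3 (iii) p.73] -/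
theorem baseInj_ofRlfRWeak_ofGaloisActionConnected
    (C₀ : TemperedFrobenioid
      (RealifiedDivisorMonoids.ofRlfRWeak (DivisorMonoids.ofGaloisActionConnected A hZ) hpf) D VD) : C₀.BaseInj :=
  BaseInj.of_hBinj C₀ fun g => RealifiedDivisorMonoids.ofRlfRWeak_hBinj_ofGaloisActionConnected A hZ hpf g

end BaseInjGenuine

/-! ### §3 Monoprime flavour of `Φ^{bs-fld}` and `ℚ`-monoprime localized perfections (census A6 / A7) -/

section Monoprime

variable {D₀ : Type u₀} [Category.{v₀} D₀] {V : FrdIMonoidStub.{w}} {T : RealifiedDivisorMonoids (D₀ := D₀) V}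
  {D : Type u} [Category.{v} D] {VD : FrdICatStub.{u, v, w} D}

/-- **`Φ^{bs-fld}(W)` is monoprime OF TYPE `ℤ` OR `ℚ` at every `W`** (census A6): Def. 3.6 (ii)(a) records «monoprime»
(the typed field `isMonoprime_bsFld` allows the `ℝ` flavour); the criterion of Cor. 3.8 (p.81) is used for
`Λ ∈ {ℤ, ℚ}`, where `Φ^{bs-fld}(W) ≅ ℤ_{≥0}·[k_W]` resp. `ℚ_{≥0}·[k_W]`.  This is abc-iut-w4-d084's binder `hΛ` of
`bsFldPreStepLimitCriterion_of_coord` VERBATIM. [cite: MochizukiEtTh2009, Def 3.6 (ii) p.77] -/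
def BsFldZQ (C : TemperedFrobenioid T D VD) : Prop :=
  ∀ W : D, IsZMonoprime ↥(C.bsFld.carrier (op W)) ∨ IsQMonoprime ↥(C.bsFld.carrier (op W))

/-- **`Φ(W)` has `ℚ`-monoprime localized perfections at every prime** (census A7, GAP G-w4d084-3): Def. 3.3 (iii)
«`Φ₀(Y)^pf ≅` a direct product of copies of `ℚ_{≥0}`» (Prop. 3.2 (i)) read for the divisor monoid `Φ ⊆ Φ₀^ℝ|_D` —
its primes are `ℤ`/`ℚ`-primes, not `ℝ`-primes.  This is abc-iut-w4-d084's binder `hQ` of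
`bsFldPreStepLimitCriterion_of_coord` VERBATIM. [cite: MochizukiEtTh2009, Def 3.3 (iii) p.73] -/
def PfAtQ (C : TemperedFrobenioid T D VD) : Prop :=
  ∀ (W : D) (𝔮 : Primes (Perfection (C.divisorMonoid.obj (op W)))), IsQMonoprime (PfAt (C.divisorMonoid.obj (op W)) 𝔮)

variable {T' : RealifiedDivisorMonoids (D₀ := D₀) treeMonoidVocab.{w}} (C : TemperedFrobenioid T' D VD)

/-- `hΛ ⇐ hQ + hNZ` on the named predicates (abc-iut-w4-d084's `isZQMonoprime_bsFld`, p431193: an `ℝ`-monoprime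
`Φ^{bs-fld}(W)` is impossible once `Φ(W)^pf` is `ℚ`-monoprime at primes and some `Z₀ ≠ 1` is base-field-theoretic).
[cite: MochizukiEtTh2009, Cor 3.8 p.81] -/
theorem bsFldZQ_of_pfAtQ (hQ : C.PfAtQ)
    (hNZ : ∀ A : Dᵒᵖ, ∃ u : (T'.BΛ.obj (C.baseOp A) : Type w) × Algebra.GrothendieckGroup (C.Φ.carrier A),
      u ∈ C.cnstFn A ∧ ∃ Z : C.Φ.carrier A, Z ≠ 1 ∧ u.2 = Algebra.GrothendieckGroup.of Z) :
    C.BsFldZQ := fun W => by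
  obtain ⟨Z₀, -, hZ₀b, hZ₀1⟩ := exists_divO_ne_one hNZ W
  exact isZQMonoprime_bsFld (hQ W) hZ₀b hZ₀1

/-- Re-key of abc-iut-w4-d084's `bsFldPreStepLimitCriterion_of_coord` (row C38-L05, Cor. 3.8 criterion for the
base-field-theoretic pre-steps) on the named predicates `BsFldZQ` (`hΛ`) and `PfAtQ` (`hQ`).
[cite: MochizukiEtTh2009, Cor 3.8 p.81] -/
theorem bsFldPreStepLimitCriterion_of_laws (hF : PreFrobenioid.IsFrobenioid C.toElem)
    (hP34Λ : ∀ (Y : D₀ᵒᵖ) (b : T'.BΛ.obj Y) (r : T'.ΦR.obj Y),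
      T'.divΛ Y b = Algebra.GrothendieckGroup.of r → b ∈ T'.FΛ Y)
    (hNZ : ∀ A : Dᵒᵖ, ∃ u : (T'.BΛ.obj (C.baseOp A) : Type w) × Algebra.GrothendieckGroup (C.Φ.carrier A),
      u ∈ C.cnstFn A ∧ ∃ Z : C.Φ.carrier A, Z ≠ 1 ∧ u.2 = Algebra.GrothendieckGroup.of Z)
    (hΛ : C.BsFldZQ) (hQ : C.PfAtQ) :
    C.BsFldPreStepLimitCriterion (PreFrobenioidData.perfection hF) :=
  bsFldPreStepLimitCriterion_of_coord C hF hP34Λ hNZ hΛ hQ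

end Monoprime

end TemperedFrobenioid

namespace Toy

/-- `BsFldZQ` HOLDS at abc-iut-L2-t3's toy (`Φ^{bs-fld} = Φ = ℕ = ℤ_{≥0}`, of type `ℤ`).
[cite: MochizukiEtTh2009, Def 3.6 (ii) p.77] -/
theorem bsFldZQ : temperedFrobenioid.BsFldZQ := fun W => by
  refine Or.inl ⟨⟨?_⟩⟩
  have htop : temperedFrobenioid.bsFld.carrier (op W) = ⊤ :=
    eq_top_iff.2 fun x _ => Submonoid.mem_inf.2 ⟨Submonoid.mem_top x,
      (Subgroup.mem_top (Algebra.GrothendieckGroup.of x) :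
        Algebra.GrothendieckGroup.of x ∈ (⊤ : Subgroup (Algebra.GrothendieckGroup (Multiplicative ℕ))))⟩
  rw [htop]
  exact Submonoid.topEquiv

end Toy

/-! ### §4 The `Λ = ℝ` effective-locus law of Prop. 3.4 (ii) (census A2) -/

namespace DivisorMonoids

variable {D₀ : Type u} [Category.{v} D₀]

/-- **The `Λ = ℝ` effective-locus law** (census A2, GAP G-w5d130-1): «an element of `ℝ·Φ₀^birat(Y)` whose image in
`(Φ₀^rlf)^gp(Y)` is [the class of] an element of `Φ₀(Y)^rlf` lies in `ℝ·Φ₀^cnst(Y)`» — the `Λ = ℝ` reading of Prop.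
3.4 (ii), isomorphisms 1–2 («effective ⇒ constant»), which print's proof of Thm. 3.7 (iii) (p.80 «follows immediately
from Proposition 3.4, (ii)») uses and which is NOT a formal consequence of the `B₀`-level data (abc-iut-w5-d130's
`√2`-cone, `Sec3Prop34CnstOfRlfRNegative`; it holds under the dual-graph law of the special fibre, abc-iut-w6-d046's
chain model).  This is abc-iut-w5-d130's binder `hE` of `Prop34Cnst.ofRlfR_of_eff` VERBATIM.
[cite: MochizukiEtTh2009, Prop 3.4 (ii) p.74] -/
def EffRealSpan (dm : DivisorMonoids.{u, v, w} D₀) (hpf : ∀ Y : D₀ᵒᵖ, IsPerfFactorial (dm.Φ₀.obj Y)) : Prop :=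
  ∀ (Y : D₀) (b : Algebra.GrothendieckGroup ((RealifiedDivisorMonoids.realData dm hpf).rlf.obj (op Y)))
    (x : (hpf (op Y)).Rlf),
    b ∈ ((RealifiedDivisorMonoids.realData dm hpf).realSpan dm.biratGp).carrier Y →
      b = Algebra.GrothendieckGroup.of x →
        b ∈ ((RealifiedDivisorMonoids.realData dm hpf).realSpan dm.cnstGp).carrier Y

variable {dm : DivisorMonoids.{u, v, w} D₀} {hpf : ∀ Y : D₀ᵒᵖ, IsPerfFactorial (dm.Φ₀.obj Y)}
  {Dcnst : Type u₁} [Category.{v₁} Dcnst] {cnst : D₀ ⥤ Dcnst}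

/-- Re-key of abc-iut-w5-d130's `Prop34Cnst.ofRlfR_of_eff` (p424819): `Prop34Cnst (ofRlfR dm hpf) cnst` from the
`B₀`-level clauses `Prop34Cnst₀` and `EffRealSpan`. [cite: MochizukiEtTh2009, Prop 3.4 (ii) p.74] -/
theorem prop34Cnst_ofRlfR_of_effRealSpan (h₀ : dm.Prop34Cnst₀ cnst) (hE : dm.EffRealSpan hpf) :
    (RealifiedDivisorMonoids.ofRlfR dm hpf).Prop34Cnst cnst :=
  RealifiedDivisorMonoids.Prop34Cnst.ofRlfR_of_eff h₀ hE

/-- Conversely clause 1 of `Prop34Cnst (ofRlfR dm hpf) cnst` IS `EffRealSpan` (abc-iut-w5-d130's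
`eff_of_prop34Cnst_ofRlfR`). [cite: MochizukiEtTh2009, Prop 3.4 (ii) p.74] -/
theorem effRealSpan_of_prop34Cnst_ofRlfR (h : (RealifiedDivisorMonoids.ofRlfR dm hpf).Prop34Cnst cnst) :
    dm.EffRealSpan hpf :=
  fun Y b x hb hbx => RealifiedDivisorMonoids.Prop34Cnst.eff_of_prop34Cnst_ofRlfR h Y b x hb hbx

/-- `EffRealSpan` ⟺ clause 1 of `Prop34Cnst (ofRlfR dm hpf) cnst`, given the `B₀`-level clauses `Prop34Cnst₀ cnst`
(so the predicate is EXACTLY the residual of row EtTh:Thm3.7(iii)/L10-R at `Λ = ℝ`).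
[cite: MochizukiEtTh2009, Prop 3.4 (ii) p.74] -/
theorem effRealSpan_iff (h₀ : dm.Prop34Cnst₀ cnst) :
    dm.EffRealSpan hpf ↔ (RealifiedDivisorMonoids.ofRlfR dm hpf).Prop34Cnst cnst :=
  ⟨prop34Cnst_ofRlfR_of_effRealSpan h₀, effRealSpan_of_prop34Cnst_ofRlfR⟩

end DivisorMonoids

namespace TemperedFrobenioid

variable {D₀ : Type u} [Category.{v} D₀] {dm : DivisorMonoids.{u, v, w} D₀}
  {hpf : ∀ Y : D₀ᵒᵖ, IsPerfFactorial (dm.Φ₀.obj Y)}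
  {D : Type u₀} [Category.{v₀} D] {VD : FrdICatStub.{u₀, v₀, w} D}
  (C₀ : TemperedFrobenioid (RealifiedDivisorMonoids.ofRlfR dm hpf) D VD)
  {Dcnst : Type u₁} [Category.{v₁} Dcnst] {cnst : D₀ ⥤ Dcnst}

/-- Re-key of `thm37_iii_withCnst_ofRlfR` (p424819): **Theorem 3.7 (iii) for a tempered Frobenioid of monoid type `ℝ`
over the constructed Def. 3.6 (i) data**, modulo `Prop34Cnst₀ cnst` and the named law `EffRealSpan`.
[cite: MochizukiEtTh2009, Thm 3.7 (iii) p.79] -/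
theorem thm37_iii_withCnst_ofRlfR_of_effRealSpan (F : FrobenioidFacade.{u₀, v₀, w} D) (h₀ : dm.Prop34Cnst₀ cnst)
    (hE : dm.EffRealSpan hpf) : C₀.Thm37_iii (F.withCnst (C₀.base ⋙ cnst)) :=
  C₀.thm37_iii_withCnst_ofRlfR F h₀ hE

end TemperedFrobenioid

/-- **`EffRealSpan` HOLDS at abc-iut-w6-d046's chain model** (infinitely many `ℚ`-primes, infinitely supported
divisors, dual-graph law; `Sec3Prop34CnstOfRlfRChainModel.eff` BY NAME). [cite: MochizukiEtTh2009, Prop 3.4 (ii) p.74] -/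
theorem Sec3Prop34CnstOfRlfRChainModel.effRealSpan :
    Sec3Prop34CnstOfRlfRChainModel.dm.EffRealSpan Sec3Prop34CnstOfRlfRChainModel.hpf :=
  fun Y b x hb hbx => Sec3Prop34CnstOfRlfRChainModel.eff Y b x hb hbx

/-- **`EffRealSpan` FAILS at abc-iut-w5-d130's `√2`-cone** (`Sec3Prop34CnstOfRlfRNegative`: `Prop34Cnst₀` holds and
`Prop34Cnst (ofRlfR dm₀ hpf₀) (𝟭 _)` fails, so clause 1 fails) — the predicate is a GENUINE interface input.
[cite: MochizukiEtTh2009, Prop 3.4 (ii) p.74] -/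
theorem Sec3Prop34CnstOfRlfRNegative.not_effRealSpan :
    ¬ Sec3Prop34CnstOfRlfRNegative.dm₀.EffRealSpan Sec3Prop34CnstOfRlfRNegative.hpf₀ :=
  fun hE => Sec3Prop34CnstOfRlfRNegative.not_prop34Cnst_ofRlfR
    (DivisorMonoids.prop34Cnst_ofRlfR_of_effRealSpan Sec3Prop34CnstOfRlfRNegative.prop34Cnst₀ hE)

end Literature.AnabelianGeometry.EtaleTheta

end
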